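import Summits.QuantumFields.QCD.Theses.HeatSlicedQuarks
import Summits.QuantumFields.QCD.Theorems.HeatSlicedQuarksQuarkLoopCoefficientDefs

/-!
# Line `Sketch` — checked skeleton for crux stmt-QuantumFields-16786
(`Summit.QuantumFields.QCD.Theses.HeatSlicedQuarks.QuarkLoopCoefficient`, rank-7 crux of route HeatSlicedQuarks;
lead prover-line-stmt-QuantumFields-16786-0, 2026-08-17; reconstruction of the line from the cards
`complex-flux-cauchy` / `schwinger-kernel-parametrix` (k2) with the k1 mechanisms
`twisted-convolution-majorant` / `single-momentum-coefficient` as registered stubs)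

Crux: for Cartan-diagonal `SU(3)` fields on `T_L = (ℤ/L)⁴` with plaquette `diag(e^{iθ},e^{−iθ},1)` in the
`(0,1)` plane and all other plaquettes trivial, the colour–spin traced on-diagonal correction
`Δ_U(t,x) = Σ_{aα} Re[e^{−tH_U} − e^{−tH_1}]((x,a,α),(x,a,α))`, `H = D_Wᴴ D_W` (massless, `r = 1`), obeys
`|Δ − (1 − cos θ)/(3π²)| ≤ Cθ²(1/t + θ²t²) + Ce^{−cL²/(t+L)}/t²` for `1 ≤ t ≤ L²`, `t|θ| ≤ 1`.

## The line

Vocabulary in `Theorems/HeatSlicedQuarksQuarkLoopCoefficientDefs.lean` (namespace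
`Summit.QuantumFields.QCD.Theorems.QuarkLoopCoefficient`).

* WINDOW `c₀ ≤ t|θ| ≤ 1` (`stub_windowBound`, provable now): plaquette deficit `2(1−cos θ) ≤ θ² ≤ (ε/r²)²`
  with `r = ⌈√t⌉`, so the CLOSED crux 8871 (`SmallFieldUltracontractivity_of`) + `stub_diagonalMonotone` +
  entries `≤ 1` give `|K_U(t)(x,a,α;x,a,α)| ≤ C/t²`; with `θt ≥ c₀` every term of the claim is `≤ C(c₀)θ⁴t²`.
* CORE `t|θ| ≤ c₀`, on the universal cover.  `stub_torusToPlane`: colour decoupling (diagonal links), the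
  exponential-series periodization `T_L ← ℤ⁴` (pattern `stub_coveringPeriodization`, now with infinite deck group),
  the abelian gauge classification on `ℤ⁴` (same plaquettes ⇒ gauge equivalent to the symmetric gauge
  `symLink (charge a θ)`) and magnetic-translation covariance give
  `K_U(t)((x,a,α),(x,a,α)) = Σ_{n∈ℤ⁴} c_n E^{(q_aθ)}_t(Ln)_{αα}`, `c_0 = 1`, `|c_n| = 1`, `E = symHeat`.
  The images `n ≠ 0` are bounded by the `t⁻²`-GAUSSIAN MAJORANT `stub_gaussianMajorant`
  (`‖E^{(θ)}_t(w)‖ ≤ C(1+t)⁻²e^{−c|w|²/(1+t+|w|)}` for `|θ|t ≤ c₀`; Peierls-dressed free parametrix + Grönwall in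
  the twisted-convolution picture, first Moyal defect vanishing because the free symbol is scalar), summed by the
  profile's image bound (`stub_freeMajorantToolkit` (6)) to `Ce^{−cL²/(t+L)}/t²` — the toron lesson of 17986
  honoured per colour with unit-modulus twists.  The `n = 0` terms: colour `2` cancels exactly against the free
  kernel; colours `0,1` give `g(θ) + g(−θ)`, `g(θ) = tr[E^{(θ)}_t(0) − E^{(0)}_t(0)]`, and the ORDER-≤3 expansion
  `stub_secondOrderExpansion` (`g(θ) = θa₁ + θ²·e2 t + θ³a₃ + O(θ⁴t²)`, zeroth-order majorant controlling the
  Dyson–Moyal tail, no derivative/Cauchy bounds) leaves `2θ²·e2 t + O(θ⁴t²)`; finally `stub_secondOrderCoefficient`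
  (`|e2 t − 1/(12π²)| ≤ C/t`: single-momentum collapse + Laplace asymptotics of one Brillouin-zone integral) and
  `|θ²/2 − (1 − cos θ)| ≤ 5θ⁴/96` give the crux.  The free inputs are `stub_freeMajorantToolkit` (contour-shift
  Gaussian bound of the BZ-integral kernel `freeKer`, profile calculus) and `stub_freeHeatCalculus` (heat equation,
  `k_0 = δ`, semigroup, the IBP identity `t·(z_νĥ) ∗ k_t + w_ν k_t = 0`, and `heatKer 1 = freeKer`, all by
  heat-equation uniqueness — no multi-dimensional Fourier inversion).

## Registered stubs (7) and who holds them
`stub_windowBound` (S/M), `stub_freeMajorantToolkit` (L), `stub_freeHeatCalculus` (M), `stub_torusToPlane` (L),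
`stub_gaussianMajorant` (L, LEAD), `stub_secondOrderExpansion` (L), `stub_secondOrderCoefficient` (L).
`QuarkLoopCoefficient_of` (§2, no `sorry`) concludes the crux BY NAME from them.
-/

noncomputable section

namespace Summit.QuantumFields.QCD.Cruxes.QuarkLoopCoefficient.Sketch

open Literature.MathematicalPhysics.QuantumLattice Literature.MathematicalPhysics.QuantumFieldTheory
open Literature.Probability.LatticeModels (Site TorusSite)
open Summit.QuantumFields.QCD.Theses.HeatSlicedQuarks
open Summit.QuantumFields.QCD.Theorems.QuarkLoopCoefficient
open scoped Matrix ComplexConjugate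

/-! ### §0 The line's named statements (the vocabulary of the stubs) -/

/-- **WindowBound** (stub, S/M; provable now from the tree): under the crux hypotheses every on-site diagonal
colour–spin entry of the massless Wilson heat kernel obeys `|K_U(t)((x,a,α),(x,a,α))| ≤ C/t²` on the whole window
`1 ≤ t ≤ L²`, `t|θ| ≤ 1`.  Mechanism: the plaquette deficit is `3 − (2cos θ + 1) = 2(1 − cos θ) ≤ θ²`; for
`t|θ| ≤ ε/4` take `r = ⌈√t⌉ ≤ L` (so `t ≤ r² ≤ 4t` and `θ² ≤ (ε/r²)²`) in the closed crux 8871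
`SmallFieldUltracontractivity_of` (with `m = 0`); for `ε/4 < t|θ| ≤ 1` use `stub_diagonalMonotone` from the time
`t₀ = max 1 (ε/(4|θ|))` (where 8871 applies, or the entry is `≤ 1` = `exp 0`) and `1/t₀² ≤ (16/ε²)/t²`. -/
def WindowBound : Prop :=
  ∃ C : ℝ, ∀ (L : ℕ) [NeZero L] (U : GaugeConfig 4 L (Matrix.specialUnitaryGroup (Fin 3) ℂ)) (θ : ℝ),
    (∀ (e : Edge 4 L) (i j : Fin 3), i ≠ j → (fundamentalRep (Fin 3)) (U e) i j = 0) →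
    (∀ y : TorusSite 4 L, (fundamentalRep (Fin 3)) (plaquetteHolonomy U y 0 1) =
        Matrix.diagonal ![Complex.exp (Complex.I * θ), Complex.exp (-(Complex.I * θ)), 1]) →
    (∀ (y : TorusSite 4 L) (μ ν : Fin 4), ¬(μ = 0 ∧ ν = 1) → ¬(μ = 1 ∧ ν = 0) →
        plaquetteHolonomy U y μ ν = 1) →
    ∀ (t : ℝ), 1 ≤ t → t ≤ (L : ℝ) ^ 2 → t * |θ| ≤ 1 →
    ∀ (x : TorusSite 4 L) (a : Fin 3) (α : Fin 4), ‖torusHeat U t (x, a, α) (x, a, α)‖ ≤ C / t ^ 2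

/-- **FreeMajorantToolkit** (stub, L; pure analysis, no operators).  (1) The free `ℤ⁴` kernel
`freeKer t w = (2π)⁻⁴∫_{[−π,π]⁴} e^{−th(p)}cos(p·w)dp` is dominated by the two-regime profile WITH the on-diagonal
prefactor: `|k_t(w)| ≤ C(1+t)⁻² e^{−c|w|²/(1+t+|w|)}` for all `t ≥ 0` (contour shift `p ↦ p + iη` coordinatewise —
the vertical sides cancel by `2π`-periodicity — with `Re h(p+iη) ≥ (1 − Cη²)h(p) − Cη²`, `h(p) ≥ c|p|²` on the zone,
`∫e^{−t h/2} ≤ Ct⁻²`, then optimise `η`: Gaussian for `|w| ≲ t`, exponential beyond).  Profile calculus of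
`Γ_c(t,w) = gaussProfile c t w`: (2) the mixed convolution `Σ_y Γ_{(1−ε)c}(a,y)Γ_c(b,w−y) ≤ BΓ_{(1−ε)c}(a+b,w)`
(exponent superadditivity `|y|²/(1+a+|y|) + |w−y|²/(1+b+|w−y|) ≥ |w|²/(2+a+b+|w|)` from Cauchy–Schwarz; the strict
part `ε` of the stronger factor localises `y` and pays the lattice entropy; prefactors `(1+a)⁻²(1+b)⁻²·(entropy) ≤
B(1+a+b)⁻²`); (3) moment absorption `|w|ʲΓ_c ≤ A(1+t)^{j/2}Γ_{(1−ε)c}`; (4) bounded shifts;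
(5) bounded mass `Σ_yΓ_c(t,y) ≤ A`; (6) the image sum over the deck group:
`Σ_{n≠0} Γ_c(t, L·n) ≤ C e^{−(c/2)L²/(t+L)}/t²` for `1 ≤ t ≤ L²` (`|n|²/(1+t+L|n|) ≥ |n|/(1+t+L)` for `|n| ≥ 1`,
product bound `e^{−a|n|} ≤ Π_μ e^{−a|n_μ|/2}`, geometric series). -/
def FreeMajorantToolkit : Prop :=
  (∃ C c : ℝ, 0 < c ∧ ∀ t : ℝ, 0 ≤ t → ∀ w : Site 4, |freeKer t w| ≤ C * gaussProfile c t w) ∧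
  (∀ c ε : ℝ, 0 < c → 0 < ε → ε < 1 → ∃ B : ℝ, ∀ a b : ℝ, 0 ≤ a → 0 ≤ b → ∀ w : Site 4,
    Summable (fun y : Site 4 => gaussProfile ((1 - ε) * c) a y * gaussProfile c b (w - y)) ∧
    ∑' y : Site 4, gaussProfile ((1 - ε) * c) a y * gaussProfile c b (w - y) ≤
      B * gaussProfile ((1 - ε) * c) (a + b) w) ∧
  (∀ c ε : ℝ, 0 < c → 0 < ε → ε < 1 → ∀ j : ℕ, ∃ A : ℝ, ∀ t : ℝ, 0 ≤ t → ∀ w : Site 4,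
    elen w ^ j * gaussProfile c t w ≤ A * Real.sqrt (1 + t) ^ j * gaussProfile ((1 - ε) * c) t w) ∧
  (∀ c ε : ℝ, 0 < c → 0 < ε → ε < 1 → ∃ A : ℝ, ∀ t : ℝ, 0 ≤ t → ∀ w z : Site 4, elen z ≤ 2 →
    gaussProfile c t (w + z) ≤ A * gaussProfile ((1 - ε) * c) t w) ∧
  (∀ c : ℝ, 0 < c → ∃ A : ℝ, ∀ t : ℝ, 0 ≤ t →
    Summable (fun y : Site 4 => gaussProfile c t y) ∧ ∑' y : Site 4, gaussProfile c t y ≤ A) ∧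
  (∀ c : ℝ, 0 < c → ∃ C : ℝ, ∀ (L : ℕ), 1 ≤ L → ∀ t : ℝ, 1 ≤ t → t ≤ (L : ℝ) ^ 2 →
    Summable (fun n : Site 4 => gaussProfile c t (fun μ => (L : ℤ) * n μ)) ∧
    ∑' n : Site 4, (if n = 0 then 0 else gaussProfile c t (fun μ => (L : ℤ) * n μ)) ≤
      C * Real.exp (-(c / 2 * (L : ℝ) ^ 2 / (t + (L : ℝ)))) / t ^ 2)

/-- **FreeHeatCalculus** (stub, M; given the toolkit for summability): the structural identities of the free
kernel, all WITHOUT multi-dimensional Fourier inversion.  (1) the free `D♯D` kernel on `ℤ⁴` is scalar in spin with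
coefficients `hhat` (finite `γ`-algebra, as the tree's `symQ_conjTranspose_mul_self`); (2) the exponential-series
heat kernel of the trivial link field IS the Brillouin-zone kernel, `heatKer 1 t x y = k_t(y−x)·1` (both solve
`∂_t K = −ĥ ∗ K`, `K_0 = δ`, in `ℓ^∞(ℤ⁴)` where `ĥ∗` is bounded: ODE uniqueness); (3) `k_0 = δ₀`
(`∫_{[−π,π]⁴} cos(p·w) = (2π)⁴δ_{w0}`, Fubini over the four coordinates); (4) the heat equation
`∂_t k_t(w) = −Σ_z ĥ(z)k_t(w−z)` (differentiate under the integral; `h(p)cos(p·w) = Σ_z ĥ(z)cos(p·(w−z))`);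
(5) the semigroup law `Σ_y k_s(y)k_r(w−y) = k_{s+r}(w)`; (6) the first-order IBP identity
`t·Σ_z z_ν ĥ(z) k_t(w−z) + w_ν k_t(w) = 0` (i.e. `(z_νĥ) ∗ k_t = −(w_ν/t)k_t`; both sides of
`F(t) = t(z_νĥ)∗k_t + w_νk_t` solve `∂_tF = −ĥ∗F`, `F(0) = 0`), from which the FIRST MOYAL CANCELLATION
`Σ_z (z∧w) ĥ(z) k_t(w−z) = 0` follows by `z∧w = z₀w₁ − z₁w₀`; (7) evenness. -/
def FreeHeatCalculus : Prop :=
  (∀ x y : Site 4, sqKer (fun _ => (1 : ℂ)) x y = ((hhat (y - x) : ℝ) : ℂ) • (1 : Spin)) ∧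
  (∀ t : ℝ, 0 ≤ t → ∀ x y : Site 4,
    heatKer (fun _ => (1 : ℂ)) t x y = ((freeKer t (y - x) : ℝ) : ℂ) • (1 : Spin)) ∧
  (∀ w : Site 4, freeKer 0 w = if w = 0 then 1 else 0) ∧
  (∀ (t : ℝ) (w : Site 4),
    HasDerivAt (fun s => freeKer s w) (-(∑ z ∈ nbr2 0, hhat z * freeKer t (w - z))) t) ∧
  (∀ s r : ℝ, 0 ≤ s → 0 ≤ r → ∀ w : Site 4,
    HasSum (fun y : Site 4 => freeKer s y * freeKer r (w - y)) (freeKer (s + r) w)) ∧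
  (∀ t : ℝ, 0 ≤ t → ∀ (w : Site 4) (ν : Fin 4),
    t * (∑ z ∈ nbr2 0, ((z ν : ℤ) : ℝ) * hhat z * freeKer t (w - z)) + ((w ν : ℤ) : ℝ) * freeKer t w = 0) ∧
  (∀ (t : ℝ) (w : Site 4), freeKer t (-w) = freeKer t w)

/-- **TorusToPlane** (stub, L; algebra + absolutely convergent series): under the crux hypotheses, for every
`t ≥ 0`, site `x`, colour `a` and spin `α`, the on-site diagonal entry of the torus heat kernel is a twisted
periodization of the symmetric-gauge heat symbol of charge `charge a θ ∈ {θ, −θ, 0}` over the deck group `Lℤ⁴`: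
`K_U(t)((x,a,α),(x,a,α)) = Σ_{n∈ℤ⁴} c_n · (symHeat (charge a θ) t (L·n))_{αα}` with `c_0 = 1`, `|c_n| = 1`.
Mechanism: (i) diagonal links ⇒ `D_W(U)` is colour-block-diagonal, block `a` = abelian Wilson operator of the
unimodular link field `u_a(e) = (U e)_{aa}` (`ρ(U e)⁻¹_{aa} = conj`), and `exp` respects blocks; (ii) periodization
through the exponential SERIES: `(H_U^m)((x,a,α),(y,a,β)) = Σ_{z ∈ π⁻¹y} (sqKerPow ũ_a m)(x̃,z)_{αβ}` for the
pulled-back field `ũ_a = u_a ∘ π` on `ℤ⁴` (paths on the torus lift uniquely; finite sums), then sum `Σ_m (−t)^m/m!`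
and swap with the fibre sum (absolutely convergent: `Σ_z‖H̃^m(x̃,z)‖ ≤ C^m`); (iii) `ũ_a` has the plaquettes of
`symLink (charge a θ)` (pull back the hypotheses; `(1,0)` plaquette = inverse of `(0,1)`), so on `ℤ⁴` (simply
connected: integrate the flat ratio along a comb from `x̃`) `ũ_a = g·symLink·ḡ(·+e_μ)` with `|g| = 1`, whence
`heatKer ũ_a t x̃ z = g(x̃) conj(g z) · heatKer (symLink _) t x̃ z` (conjugate `diracKer`, `sqKer`, the powers, the
series); (iv) magnetic-translation covariance of the symmetric gauge,
`heatKer (symLink θ') t x̃ z = e^{(iθ'/2) x̃∧z} symHeat θ' t (z − x̃)` (the links satisfy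
`u(z+v,μ) = e^{iθ'A_μ(v)}u(z,μ)`, so `diracKer`/`sqKer`/powers are covariant by induction); (v) `z = x̃ + L·n`.
Summability of the image series: `‖sqKerPow u m x y‖ ≤ C^m` and `= 0` unless `‖y − x‖ ≤ 2m`, so
`‖heatKer u t x y‖ ≤ Σ_{m ≥ ‖y−x‖/2} (Ct)^m/m!` (super-exponential in the distance). -/
def TorusToPlane : Prop :=
  ∀ (L : ℕ) [NeZero L] (U : GaugeConfig 4 L (Matrix.specialUnitaryGroup (Fin 3) ℂ)) (θ : ℝ),
    (∀ (e : Edge 4 L) (i j : Fin 3), i ≠ j → (fundamentalRep (Fin 3)) (U e) i j = 0) →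
    (∀ y : TorusSite 4 L, (fundamentalRep (Fin 3)) (plaquetteHolonomy U y 0 1) =
        Matrix.diagonal ![Complex.exp (Complex.I * θ), Complex.exp (-(Complex.I * θ)), 1]) →
    (∀ (y : TorusSite 4 L) (μ ν : Fin 4), ¬(μ = 0 ∧ ν = 1) → ¬(μ = 1 ∧ ν = 0) →
        plaquetteHolonomy U y μ ν = 1) →
    ∀ (t : ℝ), 0 ≤ t → ∀ (x : TorusSite 4 L) (a : Fin 3) (α : Fin 4),
      ∃ c : Site 4 → ℂ, c 0 = 1 ∧ (∀ n, ‖c n‖ = 1) ∧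
        HasSum (fun n : Site 4 => c n * symHeat (charge a θ) t (fun μ => (L : ℤ) * n μ) α α)
          (torusHeat U t (x, a, α) (x, a, α))

/-- **GaussianMajorant** (stub conclusion, L, LEAD): the symmetric-gauge heat symbol of weak flux is dominated,
ENTRYWISE, by the two-regime profile with the free prefactor: there are `c₀ > 0`, `C`, `c > 0` with
`‖(symHeat θ t w)_{αβ}‖ ≤ C(1+t)⁻²e^{−c|w|²/(1+t+|w|)}` whenever `0 ≤ t`, `|θ| ≤ c₀`, `|θ|t ≤ c₀`.
Mechanism (card twisted-convolution-majorant): `E_t = symHeat θ t` solves `∂_tE = −ȟ_θ ⋆_θ E`, `E_0 = δ`, with the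
twisted convolution `(f ⋆_θ g)(w) = Σ_z e^{(iθ/2)z∧w}f(z)g(w−z)`; variation of constants against the Peierls-dressed
free kernel `P_s = k_s·1` gives `E_t = P_t − ∫₀ᵗ E_{t−s} ⋆_θ Q_s ds`, `Q_s = ȟ_θ ⋆_θ k_s − ĥ ∗ k_s`; writing
`e^{iφ} = 1 + iφ + O(φ²)`, `φ = θ z∧w/2`, the linear term is the first Moyal term, which VANISHES
(`FreeHeatCalculus` (6)), so `|Q_s(w)| ≤ C(θ²(1+s) + |θ|)Γ(s,w)` (toolkit (1),(3),(4)); `|e^{iφ}| = 1`; Grönwall for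
`M(u) = sup_w ‖E_u(w)‖/Γ_{(1−ε)²c}(u,w)` with the mixed convolution (toolkit (2)):
`M(u) ≤ A + B∫₀ᵘ(θ²(1+s)+|θ|)M(u−s)ds`, and `∫₀ᵗ(θ²(1+s)+|θ|) ≤ 3c₀²/2 + c₀`.  (`M(u) < ∞` a priori: the series
bound `‖E_u(w)‖ ≤ Σ_{m≥|w|/2}(Cu)^m/m!` decays super-exponentially.) -/
def GaussianMajorant : Prop :=
  ∃ c₀ : ℝ, 0 < c₀ ∧ ∃ C c : ℝ, 0 < c ∧ ∀ θ t : ℝ, 0 ≤ t → |θ| ≤ c₀ → |θ| * t ≤ c₀ →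
    ∀ (w : Site 4) (α β : Fin 4), ‖symHeat θ t w α β‖ ≤ C * gaussProfile c t w

/-- **SecondOrderExpansion** (stub conclusion, L): the spin-traced heat symbol at the origin has a Taylor
expansion to order three in the flux with the Landau remainder, the `θ²`-coefficient being the explicit `e2 t` of
the Defs file: there are `c₀ > 0`, `C` and functions `a₁ a₃` of `t` alone with
`|tr[E^{(θ)}_t(0) − E^{(0)}_t(0)] − (θa₁(t) + θ²·e2 t + θ³a₃(t))| ≤ Cθ⁴t²` for `1 ≤ t`, `|θ|t ≤ c₀`.
Mechanism: expand the cocycle `e^{(iθ/2)(z∧v+v∧w)} = Σ_{j≤3}(…)ʲ/j! + O(θ⁴(z∧v+v∧w)⁴)` in `∂_tE = −ȟ_θ⋆_θE`;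
the coefficients `E_j` (`j ≤ 3`) solve linear inhomogeneous free heat equations,
`E_j(t) = −∫₀ᵗ k_{t−s} ∗ Σ_{i≥1} vtx i (E_{j−i}(s)) ds` (`E₀ = pert0`, `E₁ = pert1`, and `tr E₂(t)(0) = e2 t` by
definition), and are `≤ C(1+t)ʲ·(moments)·Γ` by the toolkit; the remainder `R = E − Σ_{j≤3}θʲE_j` solves
`∂_tR = −ȟ_θ⋆_θR − q₄`, `R(0) = 0`, with `|q₄(s)| ≤ Cθ⁴(1+s)³·(poly moments)·Γ`, so
`R(t) = −∫₀ᵗ E_θ(t−s) ⋆_θ q₄(s) ds` is `≤ Cθ⁴(1+t)⁴Γ(t,·)` by `GaussianMajorant` and the mixed convolution;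
at `w = 0`, `Γ(t,0) = (1+t)⁻²`. -/
def SecondOrderExpansion : Prop :=
  ∃ c₀ : ℝ, 0 < c₀ ∧ ∃ C : ℝ, ∃ a₁ a₃ : ℝ → ℂ, ∀ θ t : ℝ, 1 ≤ t → |θ| * t ≤ c₀ →
    ‖(∑ α : Fin 4, (symHeat θ t 0 α α - symHeat 0 t 0 α α)) -
        ((θ : ℂ) * a₁ t + (θ : ℂ) ^ 2 * e2 t + (θ : ℂ) ^ 3 * a₃ t)‖ ≤ C * θ ^ 4 * t ^ 2

/-- **SecondOrderCoefficient** (stub conclusion, L; card single-momentum-coefficient): the explicit second-order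
coefficient tends to the continuum Seeley–DeWitt value with a log-free `1/t` correction:
`|e2 t − 1/(12π²)| ≤ C/t` for `t ≥ 1`.  Mechanism: with the semigroup law and the IBP identities of
`FreeHeatCalculus` every term of `e2 t` collapses to `Σ_k tᵏ (g_k ∗ k_t)(0)` with finitely supported explicit `g_k`,
i.e. ONE Brillouin-zone integral `∫ e^{−th(p)} P(t,p) dp` with a trigonometric-polynomial `P`; Laplace asymptotics
at the unique zero `p = 0` of `h` (`h ≥ c|p|²` on the zone, doublers at `h ≥ 1`; substitute `p = q/√t`, Taylor
`sin, cos`, Gaussian moments `∫_{ℝ⁴} q₀²q₁²e^{−|q|²} = π²/4`, …) gives `1/(12π²) − 1/(48π²t) + O(t⁻²)`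
(numerically: `12π²·e2 = 1 − 1/(4t) + 3/(8t²) − …`, kit j021094/j021156/kappa4d to 1e-7). -/
def SecondOrderCoefficient : Prop :=
  ∃ C : ℝ, ∀ t : ℝ, 1 ≤ t → ‖e2 t - ((1 / (12 * Real.pi ^ 2) : ℝ) : ℂ)‖ ≤ C / t

/-! ### §1 Registered stubs (open; stated EXPANDED — the stub registry is textual and the landed stub files under
`Theorems/` restate these headers verbatim; the named `Prop`s of §0 unfold to them by `rfl`).  Landed stubs will be
imported theorems. -/

/-- **Stub `stub_windowBound`** (S/M; worker) = `WindowBound`, stated EXPANDED (the registry and the landed stub files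
carry the expanded text verbatim; `WindowBound` unfolds to it definitionally). -/
theorem stub_windowBound :
    (∃ C : ℝ, ∀ (L : ℕ) [NeZero L] (U : GaugeConfig 4 L (Matrix.specialUnitaryGroup (Fin 3) ℂ)) (θ : ℝ),
        (∀ (e : Edge 4 L) (i j : Fin 3), i ≠ j → (fundamentalRep (Fin 3)) (U e) i j = 0) →
        (∀ y : TorusSite 4 L, (fundamentalRep (Fin 3)) (plaquetteHolonomy U y 0 1) =
            Matrix.diagonal ![Complex.exp (Complex.I * θ), Complex.exp (-(Complex.I * θ)), 1]) →
        (∀ (y : TorusSite 4 L) (μ ν : Fin 4), ¬(μ = 0 ∧ ν = 1) → ¬(μ = 1 ∧ ν = 0) →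
            plaquetteHolonomy U y μ ν = 1) →
        ∀ (t : ℝ), 1 ≤ t → t ≤ (L : ℝ) ^ 2 → t * |θ| ≤ 1 →
        ∀ (x : TorusSite 4 L) (a : Fin 3) (α : Fin 4), ‖torusHeat U t (x, a, α) (x, a, α)‖ ≤ C / t ^ 2) := by
  sorry

/-- **Stub `stub_freeMajorantToolkit`** (L; worker) = `FreeMajorantToolkit`, expanded. -/
theorem stub_freeMajorantToolkit :
    ((∃ C c : ℝ, 0 < c ∧ ∀ t : ℝ, 0 ≤ t → ∀ w : Site 4, |freeKer t w| ≤ C * gaussProfile c t w) ∧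
      (∀ c ε : ℝ, 0 < c → 0 < ε → ε < 1 → ∃ B : ℝ, ∀ a b : ℝ, 0 ≤ a → 0 ≤ b → ∀ w : Site 4,
        Summable (fun y : Site 4 => gaussProfile ((1 - ε) * c) a y * gaussProfile c b (w - y)) ∧
        ∑' y : Site 4, gaussProfile ((1 - ε) * c) a y * gaussProfile c b (w - y) ≤
          B * gaussProfile ((1 - ε) * c) (a + b) w) ∧
      (∀ c ε : ℝ, 0 < c → 0 < ε → ε < 1 → ∀ j : ℕ, ∃ A : ℝ, ∀ t : ℝ, 0 ≤ t → ∀ w : Site 4,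
        elen w ^ j * gaussProfile c t w ≤ A * Real.sqrt (1 + t) ^ j * gaussProfile ((1 - ε) * c) t w) ∧
      (∀ c ε : ℝ, 0 < c → 0 < ε → ε < 1 → ∃ A : ℝ, ∀ t : ℝ, 0 ≤ t → ∀ w z : Site 4, elen z ≤ 2 →
        gaussProfile c t (w + z) ≤ A * gaussProfile ((1 - ε) * c) t w) ∧
      (∀ c : ℝ, 0 < c → ∃ A : ℝ, ∀ t : ℝ, 0 ≤ t →
        Summable (fun y : Site 4 => gaussProfile c t y) ∧ ∑' y : Site 4, gaussProfile c t y ≤ A) ∧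
      (∀ c : ℝ, 0 < c → ∃ C : ℝ, ∀ (L : ℕ), 1 ≤ L → ∀ t : ℝ, 1 ≤ t → t ≤ (L : ℝ) ^ 2 →
        Summable (fun n : Site 4 => gaussProfile c t (fun μ => (L : ℤ) * n μ)) ∧
        ∑' n : Site 4, (if n = 0 then 0 else gaussProfile c t (fun μ => (L : ℤ) * n μ)) ≤
          C * Real.exp (-(c / 2 * (L : ℝ) ^ 2 / (t + (L : ℝ)))) / t ^ 2)) := by
  sorry

/-- **Stub `stub_freeHeatCalculus`** (M; worker) = `FreeMajorantToolkit → FreeHeatCalculus`, expanded (the toolkit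
supplies the decay needed for summability / dominated convergence in the ODE-uniqueness arguments). -/
theorem stub_freeHeatCalculus :
    ((∃ C c : ℝ, 0 < c ∧ ∀ t : ℝ, 0 ≤ t → ∀ w : Site 4, |freeKer t w| ≤ C * gaussProfile c t w) ∧
      (∀ c ε : ℝ, 0 < c → 0 < ε → ε < 1 → ∃ B : ℝ, ∀ a b : ℝ, 0 ≤ a → 0 ≤ b → ∀ w : Site 4,
        Summable (fun y : Site 4 => gaussProfile ((1 - ε) * c) a y * gaussProfile c b (w - y)) ∧
        ∑' y : Site 4, gaussProfile ((1 - ε) * c) a y * gaussProfile c b (w - y) ≤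
          B * gaussProfile ((1 - ε) * c) (a + b) w) ∧
      (∀ c ε : ℝ, 0 < c → 0 < ε → ε < 1 → ∀ j : ℕ, ∃ A : ℝ, ∀ t : ℝ, 0 ≤ t → ∀ w : Site 4,
        elen w ^ j * gaussProfile c t w ≤ A * Real.sqrt (1 + t) ^ j * gaussProfile ((1 - ε) * c) t w) ∧
      (∀ c ε : ℝ, 0 < c → 0 < ε → ε < 1 → ∃ A : ℝ, ∀ t : ℝ, 0 ≤ t → ∀ w z : Site 4, elen z ≤ 2 →
        gaussProfile c t (w + z) ≤ A * gaussProfile ((1 - ε) * c) t w) ∧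
      (∀ c : ℝ, 0 < c → ∃ A : ℝ, ∀ t : ℝ, 0 ≤ t →
        Summable (fun y : Site 4 => gaussProfile c t y) ∧ ∑' y : Site 4, gaussProfile c t y ≤ A) ∧
      (∀ c : ℝ, 0 < c → ∃ C : ℝ, ∀ (L : ℕ), 1 ≤ L → ∀ t : ℝ, 1 ≤ t → t ≤ (L : ℝ) ^ 2 →
        Summable (fun n : Site 4 => gaussProfile c t (fun μ => (L : ℤ) * n μ)) ∧
        ∑' n : Site 4, (if n = 0 then 0 else gaussProfile c t (fun μ => (L : ℤ) * n μ)) ≤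
          C * Real.exp (-(c / 2 * (L : ℝ) ^ 2 / (t + (L : ℝ)))) / t ^ 2)) →
    ((∀ x y : Site 4, sqKer (fun _ => (1 : ℂ)) x y = ((hhat (y - x) : ℝ) : ℂ) • (1 : Spin)) ∧
      (∀ t : ℝ, 0 ≤ t → ∀ x y : Site 4,
        heatKer (fun _ => (1 : ℂ)) t x y = ((freeKer t (y - x) : ℝ) : ℂ) • (1 : Spin)) ∧
      (∀ w : Site 4, freeKer 0 w = if w = 0 then 1 else 0) ∧
      (∀ (t : ℝ) (w : Site 4),
        HasDerivAt (fun s => freeKer s w) (-(∑ z ∈ nbr2 0, hhat z * freeKer t (w - z))) t) ∧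
      (∀ s r : ℝ, 0 ≤ s → 0 ≤ r → ∀ w : Site 4,
        HasSum (fun y : Site 4 => freeKer s y * freeKer r (w - y)) (freeKer (s + r) w)) ∧
      (∀ t : ℝ, 0 ≤ t → ∀ (w : Site 4) (ν : Fin 4),
        t * (∑ z ∈ nbr2 0, ((z ν : ℤ) : ℝ) * hhat z * freeKer t (w - z)) + ((w ν : ℤ) : ℝ) * freeKer t w = 0) ∧
      (∀ (t : ℝ) (w : Site 4), freeKer t (-w) = freeKer t w)) := by
  sorry

/-- **Stub `stub_torusToPlane`** (L; worker) = `TorusToPlane`, expanded. -/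
theorem stub_torusToPlane :
    (∀ (L : ℕ) [NeZero L] (U : GaugeConfig 4 L (Matrix.specialUnitaryGroup (Fin 3) ℂ)) (θ : ℝ),
        (∀ (e : Edge 4 L) (i j : Fin 3), i ≠ j → (fundamentalRep (Fin 3)) (U e) i j = 0) →
        (∀ y : TorusSite 4 L, (fundamentalRep (Fin 3)) (plaquetteHolonomy U y 0 1) =
            Matrix.diagonal ![Complex.exp (Complex.I * θ), Complex.exp (-(Complex.I * θ)), 1]) →
        (∀ (y : TorusSite 4 L) (μ ν : Fin 4), ¬(μ = 0 ∧ ν = 1) → ¬(μ = 1 ∧ ν = 0) →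
            plaquetteHolonomy U y μ ν = 1) →
        ∀ (t : ℝ), 0 ≤ t → ∀ (x : TorusSite 4 L) (a : Fin 3) (α : Fin 4),
          ∃ c : Site 4 → ℂ, c 0 = 1 ∧ (∀ n, ‖c n‖ = 1) ∧
            HasSum (fun n : Site 4 => c n * symHeat (charge a θ) t (fun μ => (L : ℤ) * n μ) α α)
              (torusHeat U t (x, a, α) (x, a, α))) := by
  sorry

/-- **Stub `stub_gaussianMajorant`** (L; LEAD) = `FreeMajorantToolkit → FreeHeatCalculus → GaussianMajorant`, expanded. -/
theorem stub_gaussianMajorant :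
    ((∃ C c : ℝ, 0 < c ∧ ∀ t : ℝ, 0 ≤ t → ∀ w : Site 4, |freeKer t w| ≤ C * gaussProfile c t w) ∧
      (∀ c ε : ℝ, 0 < c → 0 < ε → ε < 1 → ∃ B : ℝ, ∀ a b : ℝ, 0 ≤ a → 0 ≤ b → ∀ w : Site 4,
        Summable (fun y : Site 4 => gaussProfile ((1 - ε) * c) a y * gaussProfile c b (w - y)) ∧
        ∑' y : Site 4, gaussProfile ((1 - ε) * c) a y * gaussProfile c b (w - y) ≤
          B * gaussProfile ((1 - ε) * c) (a + b) w) ∧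
      (∀ c ε : ℝ, 0 < c → 0 < ε → ε < 1 → ∀ j : ℕ, ∃ A : ℝ, ∀ t : ℝ, 0 ≤ t → ∀ w : Site 4,
        elen w ^ j * gaussProfile c t w ≤ A * Real.sqrt (1 + t) ^ j * gaussProfile ((1 - ε) * c) t w) ∧
      (∀ c ε : ℝ, 0 < c → 0 < ε → ε < 1 → ∃ A : ℝ, ∀ t : ℝ, 0 ≤ t → ∀ w z : Site 4, elen z ≤ 2 →
        gaussProfile c t (w + z) ≤ A * gaussProfile ((1 - ε) * c) t w) ∧
      (∀ c : ℝ, 0 < c → ∃ A : ℝ, ∀ t : ℝ, 0 ≤ t →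
        Summable (fun y : Site 4 => gaussProfile c t y) ∧ ∑' y : Site 4, gaussProfile c t y ≤ A) ∧
      (∀ c : ℝ, 0 < c → ∃ C : ℝ, ∀ (L : ℕ), 1 ≤ L → ∀ t : ℝ, 1 ≤ t → t ≤ (L : ℝ) ^ 2 →
        Summable (fun n : Site 4 => gaussProfile c t (fun μ => (L : ℤ) * n μ)) ∧
        ∑' n : Site 4, (if n = 0 then 0 else gaussProfile c t (fun μ => (L : ℤ) * n μ)) ≤
          C * Real.exp (-(c / 2 * (L : ℝ) ^ 2 / (t + (L : ℝ)))) / t ^ 2)) →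
    ((∀ x y : Site 4, sqKer (fun _ => (1 : ℂ)) x y = ((hhat (y - x) : ℝ) : ℂ) • (1 : Spin)) ∧
      (∀ t : ℝ, 0 ≤ t → ∀ x y : Site 4,
        heatKer (fun _ => (1 : ℂ)) t x y = ((freeKer t (y - x) : ℝ) : ℂ) • (1 : Spin)) ∧
      (∀ w : Site 4, freeKer 0 w = if w = 0 then 1 else 0) ∧
      (∀ (t : ℝ) (w : Site 4),
        HasDerivAt (fun s => freeKer s w) (-(∑ z ∈ nbr2 0, hhat z * freeKer t (w - z))) t) ∧
      (∀ s r : ℝ, 0 ≤ s → 0 ≤ r → ∀ w : Site 4,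
        HasSum (fun y : Site 4 => freeKer s y * freeKer r (w - y)) (freeKer (s + r) w)) ∧
      (∀ t : ℝ, 0 ≤ t → ∀ (w : Site 4) (ν : Fin 4),
        t * (∑ z ∈ nbr2 0, ((z ν : ℤ) : ℝ) * hhat z * freeKer t (w - z)) + ((w ν : ℤ) : ℝ) * freeKer t w = 0) ∧
      (∀ (t : ℝ) (w : Site 4), freeKer t (-w) = freeKer t w)) →
    (∃ c₀ : ℝ, 0 < c₀ ∧ ∃ C c : ℝ, 0 < c ∧ ∀ θ t : ℝ, 0 ≤ t → |θ| ≤ c₀ → |θ| * t ≤ c₀ →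
        ∀ (w : Site 4) (α β : Fin 4), ‖symHeat θ t w α β‖ ≤ C * gaussProfile c t w) := by
  sorry

/-- **Stub `stub_secondOrderExpansion`** (L; worker) =
`FreeMajorantToolkit → FreeHeatCalculus → GaussianMajorant → SecondOrderExpansion`, expanded. -/
theorem stub_secondOrderExpansion :
    ((∃ C c : ℝ, 0 < c ∧ ∀ t : ℝ, 0 ≤ t → ∀ w : Site 4, |freeKer t w| ≤ C * gaussProfile c t w) ∧
      (∀ c ε : ℝ, 0 < c → 0 < ε → ε < 1 → ∃ B : ℝ, ∀ a b : ℝ, 0 ≤ a → 0 ≤ b → ∀ w : Site 4,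
        Summable (fun y : Site 4 => gaussProfile ((1 - ε) * c) a y * gaussProfile c b (w - y)) ∧
        ∑' y : Site 4, gaussProfile ((1 - ε) * c) a y * gaussProfile c b (w - y) ≤
          B * gaussProfile ((1 - ε) * c) (a + b) w) ∧
      (∀ c ε : ℝ, 0 < c → 0 < ε → ε < 1 → ∀ j : ℕ, ∃ A : ℝ, ∀ t : ℝ, 0 ≤ t → ∀ w : Site 4,
        elen w ^ j * gaussProfile c t w ≤ A * Real.sqrt (1 + t) ^ j * gaussProfile ((1 - ε) * c) t w) ∧
      (∀ c ε : ℝ, 0 < c → 0 < ε → ε < 1 → ∃ A : ℝ, ∀ t : ℝ, 0 ≤ t → ∀ w z : Site 4, elen z ≤ 2 →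
        gaussProfile c t (w + z) ≤ A * gaussProfile ((1 - ε) * c) t w) ∧
      (∀ c : ℝ, 0 < c → ∃ A : ℝ, ∀ t : ℝ, 0 ≤ t →
        Summable (fun y : Site 4 => gaussProfile c t y) ∧ ∑' y : Site 4, gaussProfile c t y ≤ A) ∧
      (∀ c : ℝ, 0 < c → ∃ C : ℝ, ∀ (L : ℕ), 1 ≤ L → ∀ t : ℝ, 1 ≤ t → t ≤ (L : ℝ) ^ 2 →
        Summable (fun n : Site 4 => gaussProfile c t (fun μ => (L : ℤ) * n μ)) ∧
        ∑' n : Site 4, (if n = 0 then 0 else gaussProfile c t (fun μ => (L : ℤ) * n μ)) ≤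
          C * Real.exp (-(c / 2 * (L : ℝ) ^ 2 / (t + (L : ℝ)))) / t ^ 2)) →
    ((∀ x y : Site 4, sqKer (fun _ => (1 : ℂ)) x y = ((hhat (y - x) : ℝ) : ℂ) • (1 : Spin)) ∧
      (∀ t : ℝ, 0 ≤ t → ∀ x y : Site 4,
        heatKer (fun _ => (1 : ℂ)) t x y = ((freeKer t (y - x) : ℝ) : ℂ) • (1 : Spin)) ∧
      (∀ w : Site 4, freeKer 0 w = if w = 0 then 1 else 0) ∧
      (∀ (t : ℝ) (w : Site 4),
        HasDerivAt (fun s => freeKer s w) (-(∑ z ∈ nbr2 0, hhat z * freeKer t (w - z))) t) ∧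
      (∀ s r : ℝ, 0 ≤ s → 0 ≤ r → ∀ w : Site 4,
        HasSum (fun y : Site 4 => freeKer s y * freeKer r (w - y)) (freeKer (s + r) w)) ∧
      (∀ t : ℝ, 0 ≤ t → ∀ (w : Site 4) (ν : Fin 4),
        t * (∑ z ∈ nbr2 0, ((z ν : ℤ) : ℝ) * hhat z * freeKer t (w - z)) + ((w ν : ℤ) : ℝ) * freeKer t w = 0) ∧
      (∀ (t : ℝ) (w : Site 4), freeKer t (-w) = freeKer t w)) →
    (∃ c₀ : ℝ, 0 < c₀ ∧ ∃ C c : ℝ, 0 < c ∧ ∀ θ t : ℝ, 0 ≤ t → |θ| ≤ c₀ → |θ| * t ≤ c₀ →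
        ∀ (w : Site 4) (α β : Fin 4), ‖symHeat θ t w α β‖ ≤ C * gaussProfile c t w) →
    (∃ c₀ : ℝ, 0 < c₀ ∧ ∃ C : ℝ, ∃ a₁ a₃ : ℝ → ℂ, ∀ θ t : ℝ, 1 ≤ t → |θ| * t ≤ c₀ →
        ‖(∑ α : Fin 4, (symHeat θ t 0 α α - symHeat 0 t 0 α α)) -
            ((θ : ℂ) * a₁ t + (θ : ℂ) ^ 2 * e2 t + (θ : ℂ) ^ 3 * a₃ t)‖ ≤ C * θ ^ 4 * t ^ 2) := by
  sorry

/-- **Stub `stub_secondOrderCoefficient`** (L; worker) =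
`FreeMajorantToolkit → FreeHeatCalculus → SecondOrderCoefficient`, expanded. -/
theorem stub_secondOrderCoefficient :
    ((∃ C c : ℝ, 0 < c ∧ ∀ t : ℝ, 0 ≤ t → ∀ w : Site 4, |freeKer t w| ≤ C * gaussProfile c t w) ∧
      (∀ c ε : ℝ, 0 < c → 0 < ε → ε < 1 → ∃ B : ℝ, ∀ a b : ℝ, 0 ≤ a → 0 ≤ b → ∀ w : Site 4,
        Summable (fun y : Site 4 => gaussProfile ((1 - ε) * c) a y * gaussProfile c b (w - y)) ∧
        ∑' y : Site 4, gaussProfile ((1 - ε) * c) a y * gaussProfile c b (w - y) ≤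
          B * gaussProfile ((1 - ε) * c) (a + b) w) ∧
      (∀ c ε : ℝ, 0 < c → 0 < ε → ε < 1 → ∀ j : ℕ, ∃ A : ℝ, ∀ t : ℝ, 0 ≤ t → ∀ w : Site 4,
        elen w ^ j * gaussProfile c t w ≤ A * Real.sqrt (1 + t) ^ j * gaussProfile ((1 - ε) * c) t w) ∧
      (∀ c ε : ℝ, 0 < c → 0 < ε → ε < 1 → ∃ A : ℝ, ∀ t : ℝ, 0 ≤ t → ∀ w z : Site 4, elen z ≤ 2 →
        gaussProfile c t (w + z) ≤ A * gaussProfile ((1 - ε) * c) t w) ∧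
      (∀ c : ℝ, 0 < c → ∃ A : ℝ, ∀ t : ℝ, 0 ≤ t →
        Summable (fun y : Site 4 => gaussProfile c t y) ∧ ∑' y : Site 4, gaussProfile c t y ≤ A) ∧
      (∀ c : ℝ, 0 < c → ∃ C : ℝ, ∀ (L : ℕ), 1 ≤ L → ∀ t : ℝ, 1 ≤ t → t ≤ (L : ℝ) ^ 2 →
        Summable (fun n : Site 4 => gaussProfile c t (fun μ => (L : ℤ) * n μ)) ∧
        ∑' n : Site 4, (if n = 0 then 0 else gaussProfile c t (fun μ => (L : ℤ) * n μ)) ≤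
          C * Real.exp (-(c / 2 * (L : ℝ) ^ 2 / (t + (L : ℝ)))) / t ^ 2)) →
    ((∀ x y : Site 4, sqKer (fun _ => (1 : ℂ)) x y = ((hhat (y - x) : ℝ) : ℂ) • (1 : Spin)) ∧
      (∀ t : ℝ, 0 ≤ t → ∀ x y : Site 4,
        heatKer (fun _ => (1 : ℂ)) t x y = ((freeKer t (y - x) : ℝ) : ℂ) • (1 : Spin)) ∧
      (∀ w : Site 4, freeKer 0 w = if w = 0 then 1 else 0) ∧
      (∀ (t : ℝ) (w : Site 4),
        HasDerivAt (fun s => freeKer s w) (-(∑ z ∈ nbr2 0, hhat z * freeKer t (w - z))) t) ∧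
      (∀ s r : ℝ, 0 ≤ s → 0 ≤ r → ∀ w : Site 4,
        HasSum (fun y : Site 4 => freeKer s y * freeKer r (w - y)) (freeKer (s + r) w)) ∧
      (∀ t : ℝ, 0 ≤ t → ∀ (w : Site 4) (ν : Fin 4),
        t * (∑ z ∈ nbr2 0, ((z ν : ℤ) : ℝ) * hhat z * freeKer t (w - z)) + ((w ν : ℤ) : ℝ) * freeKer t w = 0) ∧
      (∀ (t : ℝ) (w : Site 4), freeKer t (-w) = freeKer t w)) →
    (∃ C : ℝ, ∀ t : ℝ, 1 ≤ t → ‖e2 t - ((1 / (12 * Real.pi ^ 2) : ℝ) : ℂ)‖ ≤ C / t) := by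
  sorry

/-! ### §2 Composition (no `sorry` below this line) -/

/-- The Gaussian majorant from the stubs. -/
theorem gaussianMajorant_holds : GaussianMajorant :=
  stub_gaussianMajorant stub_freeMajorantToolkit (stub_freeHeatCalculus stub_freeMajorantToolkit)

/-- The second-order expansion from the stubs. -/
theorem secondOrderExpansion_holds : SecondOrderExpansion :=
  stub_secondOrderExpansion stub_freeMajorantToolkit (stub_freeHeatCalculus stub_freeMajorantToolkit)
    gaussianMajorant_holds

/-- The second-order coefficient asymptotics from the stubs. -/
theorem secondOrderCoefficient_holds : SecondOrderCoefficient :=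
  stub_secondOrderCoefficient stub_freeMajorantToolkit (stub_freeHeatCalculus stub_freeMajorantToolkit)

/-! #### §2.1 The free configuration satisfies the crux hypotheses with `θ = 0` -/

/-- Off-diagonal entries of the free links vanish. -/
theorem free_offdiag (L : ℕ) :
    ∀ (e : Edge 4 L) (i j : Fin 3), i ≠ j →
      (fundamentalRep (Fin 3)) ((fun _ : Edge 4 L => (1 : Matrix.specialUnitaryGroup (Fin 3) ℂ)) e) i j = 0 := by
  intro e i j hij
  simp [Matrix.one_apply_ne hij]

/-- The `(0,1)` plaquettes of the free configuration are `diag(e^{i0}, e^{−i0}, 1)`. -/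
theorem free_flux (L : ℕ) :
    ∀ y : TorusSite 4 L, (fundamentalRep (Fin 3))
        (plaquetteHolonomy (fun _ : Edge 4 L => (1 : Matrix.specialUnitaryGroup (Fin 3) ℂ)) y 0 1) =
      Matrix.diagonal ![Complex.exp (Complex.I * (0 : ℝ)), Complex.exp (-(Complex.I * (0 : ℝ))), 1] := by
  intro y
  have h1 : plaquetteHolonomy (fun _ : Edge 4 L => (1 : Matrix.specialUnitaryGroup (Fin 3) ℂ)) y 0 1 = 1 := by
    simp [plaquetteHolonomy]
  rw [h1, map_one]
  ext i j
  fin_cases i <;> fin_cases j <;> simp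

/-- All plaquettes of the free configuration are trivial. -/
theorem free_flat (L : ℕ) :
    ∀ (y : TorusSite 4 L) (μ ν : Fin 4), ¬(μ = 0 ∧ ν = 1) → ¬(μ = 1 ∧ ν = 0) →
      plaquetteHolonomy (fun _ : Edge 4 L => (1 : Matrix.specialUnitaryGroup (Fin 3) ℂ)) y μ ν = 1 := by
  intro y μ ν _ _
  simp [plaquetteHolonomy]

/-! #### §2.2 Elementary facts -/

/-- `charge a 0 = 0`. -/
theorem charge_zero (a : Fin 3) : charge a 0 = 0 := by
  simp [charge]

/-- `|charge a θ| ≤ |θ|`. -/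
theorem abs_charge_le (a : Fin 3) (θ : ℝ) : |charge a θ| ≤ |θ| := by
  unfold charge
  split_ifs <;> simp

/-- The colour sum of a function of the charge: `f θ + f (−θ) + f 0`. -/
theorem sum_charge (f : ℝ → ℝ) (θ : ℝ) : ∑ a : Fin 3, f (charge a θ) = f θ + f (-θ) + f 0 := by
  simp [charge, Fin.sum_univ_three]

/-- The deck vector of `0` is `0`. -/
theorem deck_zero (L : ℕ) : (fun μ : Fin 4 => (L : ℤ) * (0 : Site 4) μ) = 0 := by
  funext μ; simp

/-- `gaussProfile` is nonnegative. -/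
theorem gaussProfile_nonneg (c t : ℝ) (w : Site 4) : 0 ≤ gaussProfile c t w := by
  unfold gaussProfile
  positivity

/-- The cosine remainder: `|θ²/2 − (1 − cos θ)| ≤ (5/96) θ⁴` for `|θ| ≤ 1`. -/
theorem cos_main_term {θ : ℝ} (hθ : |θ| ≤ 1) :
    |θ ^ 2 / (6 * Real.pi ^ 2) - (1 - Real.cos θ) / (3 * Real.pi ^ 2)| ≤ 5 / 96 * θ ^ 4 := by
  have hb := Real.cos_bound hθ
  have hpi : 1 ≤ 3 * Real.pi ^ 2 := by nlinarith [Real.pi_gt_three]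
  have key : θ ^ 2 / (6 * Real.pi ^ 2) - (1 - Real.cos θ) / (3 * Real.pi ^ 2) =
      (Real.cos θ - (1 - θ ^ 2 / 2)) / (3 * Real.pi ^ 2) := by
    field_simp
    ring
  rw [key, abs_div, abs_of_pos (by positivity : (0:ℝ) < 3 * Real.pi ^ 2)]
  calc |Real.cos θ - (1 - θ ^ 2 / 2)| / (3 * Real.pi ^ 2)
      ≤ |Real.cos θ - (1 - θ ^ 2 / 2)| / 1 :=
        div_le_div_of_nonneg_left (abs_nonneg _) one_pos hpi
    _ ≤ |θ| ^ 4 * (5 / 96) := by rw [div_one]; exact hb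
    _ = 5 / 96 * θ ^ 4 := by rw [pow_abs, abs_of_nonneg (by positivity : (0:ℝ) ≤ θ ^ 4)]; ring

/-! #### §2.3 Images: the tail of the twisted periodization -/

/-- From a `HasSum` representation and a nonnegative summable majorant of the summands off the origin, the value
differs from the `n = 0` term by at most the majorant's image sum. -/
theorem image_tail {F : Site 4 → ℂ} {S : ℂ} (hF : HasSum F S) {g : Site 4 → ℝ}
    (hg : Summable g) (hg0 : ∀ n, 0 ≤ g n) (hle : ∀ n, n ≠ 0 → ‖F n‖ ≤ g n) :
    ‖S - F 0‖ ≤ ∑' n : Site 4, (if n = 0 then 0 else g n) := by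
  classical
  have hsum : Summable F := hF.summable
  have hsplit : ∑' n, F n = F 0 + ∑' n, (if n = 0 then 0 else F n) := hsum.tsum_eq_add_tsum_ite 0
  have hS : S - F 0 = ∑' n, (if n = 0 then 0 else F n) := by
    rw [← hF.tsum_eq, hsplit]; ring
  have hpt : ∀ n, ‖(if n = 0 then 0 else F n)‖ ≤ (if n = 0 then 0 else g n) := by
    intro n
    split_ifs with h
    · simp
    · exact hle n h
  have hg' : Summable (fun n : Site 4 => if n = 0 then 0 else g n) := by
    refine Summable.of_nonneg_of_le (fun n => ?_) (fun n => ?_) hg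
    · split_ifs
      · exact le_rfl
      · exact hg0 n
    · split_ifs
      · exact hg0 n
      · exact le_rfl
  have hnorm : Summable (fun n : Site 4 => ‖(if n = 0 then 0 else F n)‖) :=
    Summable.of_nonneg_of_le (fun n => norm_nonneg _) hpt hg'
  rw [hS]
  exact (norm_tsum_le_tsum_norm hnorm).trans (hnorm.tsum_le_tsum hpt hg')

/-! #### §2.4 The crux -/

/-- The analytic heart of the composition, with the two on-site kernels abstracted: given the window bounds
(`stub_windowBound`) and the twisted periodizations (`stub_torusToPlane`) of `K_U` and `K_1` at the twelve
colour–spin indices, the traced difference is within the crux's envelope of `(1 − cos θ)/(3π²)`. -/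
theorem traced_bound (C_W : ℝ) : ∃ C c : ℝ, 0 < c ∧ ∀ (L : ℕ), 1 ≤ L → ∀ (θ t : ℝ),
    1 ≤ t → t ≤ (L : ℝ) ^ 2 → t * |θ| ≤ 1 → ∀ (KU K1 : Fin 3 → Fin 4 → ℂ),
    (∀ (a : Fin 3) (α : Fin 4), ‖KU a α‖ ≤ C_W / t ^ 2) →
    (∀ (a : Fin 3) (α : Fin 4), ‖K1 a α‖ ≤ C_W / t ^ 2) →
    (∀ (a : Fin 3) (α : Fin 4), ∃ c : Site 4 → ℂ, c 0 = 1 ∧ (∀ n, ‖c n‖ = 1) ∧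
        HasSum (fun n : Site 4 => c n * symHeat (charge a θ) t (fun μ => (L : ℤ) * n μ) α α) (KU a α)) →
    (∀ (a : Fin 3) (α : Fin 4), ∃ c : Site 4 → ℂ, c 0 = 1 ∧ (∀ n, ‖c n‖ = 1) ∧
        HasSum (fun n : Site 4 => c n * symHeat (charge a 0) t (fun μ => (L : ℤ) * n μ) α α) (K1 a α)) →
    |(∑ a : Fin 3, ∑ α : Fin 4, (KU a α).re) - (∑ a : Fin 3, ∑ α : Fin 4, (K1 a α).re) -
        (1 - Real.cos θ) / (3 * Real.pi ^ 2)| ≤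
      C * θ ^ 2 * (1 / t + θ ^ 2 * t ^ 2) + C * Real.exp (-(c * (L : ℝ) ^ 2 / (t + (L : ℝ)))) / t ^ 2 := by
  classical
  obtain ⟨c₁, hc₁, C_G, c_G, hc_G, hG⟩ := gaussianMajorant_holds
  obtain ⟨c₂, hc₂, C_E, a₁, a₃, hE⟩ := secondOrderExpansion_holds
  obtain ⟨C_κ, hκ⟩ := secondOrderCoefficient_holds
  obtain ⟨C_I, hI⟩ := stub_freeMajorantToolkit.2.2.2.2.2 c_G hc_G
  -- nonnegative versions of the constants
  set CW : ℝ := max C_W 0 with hCWdef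
  set CG : ℝ := max C_G 0 with hCGdef
  set CE : ℝ := max C_E 0 with hCEdef
  set Cκ : ℝ := max C_κ 0 with hCκdef
  set CI : ℝ := max C_I 0 with hCIdef
  have hCW0 : 0 ≤ CW := le_max_right _ _
  have hCG0 : 0 ≤ CG := le_max_right _ _
  have hCE0 : 0 ≤ CE := le_max_right _ _
  have hCκ0 : 0 ≤ Cκ := le_max_right _ _
  have hCI0 : 0 ≤ CI := le_max_right _ _
  have hCWle : C_W ≤ CW := le_max_left _ _
  have hCGle : C_G ≤ CG := le_max_left _ _
  have hCEle : C_E ≤ CE := le_max_left _ _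
  have hCκle : C_κ ≤ Cκ := le_max_left _ _
  have hCIle : C_I ≤ CI := le_max_left _ _
  set c₀ : ℝ := min (min c₁ c₂) 1 with hc₀def
  have hc₀ : 0 < c₀ := lt_min (lt_min hc₁ hc₂) one_pos
  have hc₀₁ : c₀ ≤ c₁ := (min_le_left _ _).trans (min_le_left _ _)
  have hc₀₂ : c₀ ≤ c₂ := (min_le_left _ _).trans (min_le_right _ _)
  have hc₀1 : c₀ ≤ 1 := min_le_right _ _
  set Cwin : ℝ := 24 * CW / c₀ ^ 4 + 1 / (6 * Real.pi ^ 2 * c₀ ^ 2) with hCwindef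
  have hCwin0 : 0 ≤ Cwin := by positivity
  set C : ℝ := max (max (2 * Cκ) (2 * CE + 5 / 96 + Cwin)) (24 * CG * CI) with hCdef
  have hC1 : 2 * Cκ ≤ C := (le_max_left _ _).trans (le_max_left _ _)
  have hC2 : 2 * CE + 5 / 96 + Cwin ≤ C := (le_max_right _ _).trans (le_max_left _ _)
  have hC3 : 24 * CG * CI ≤ C := le_max_right _ _
  have hC0 : 0 ≤ C := le_trans (by positivity) hC3
  clear_value CW CG CE Cκ CI c₀ Cwin C
  refine ⟨C, c_G / 2, by positivity, ?_⟩
  intro L hL1 θ t ht htL htθ KU K1 hKUw hK1w hrepU hrepF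
  have ht0 : 0 < t := lt_of_lt_of_le one_pos ht
  have ht2 : 0 < t ^ 2 := by positivity
  -- the exponential tail factor
  set Etail : ℝ := Real.exp (-(c_G / 2 * (L : ℝ) ^ 2 / (t + (L : ℝ)))) with hEtaildef
  have hEtail0 : 0 ≤ Etail := (Real.exp_pos _).le
  -- restate the goal additively
  suffices key : |(∑ a : Fin 3, ∑ α : Fin 4, (KU a α).re) - (∑ a : Fin 3, ∑ α : Fin 4, (K1 a α).re) -
      (1 - Real.cos θ) / (3 * Real.pi ^ 2)| ≤
      C * θ ^ 2 / t + C * θ ^ 4 * t ^ 2 + C * Etail / t ^ 2 by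
    have hrhs : C * θ ^ 2 / t + C * θ ^ 4 * t ^ 2 + C * Etail / t ^ 2 =
        C * θ ^ 2 * (1 / t + θ ^ 2 * t ^ 2) + C * Etail / t ^ 2 := by
      field_simp
    rw [hrhs] at key
    exact key
  -- main term abbreviation
  set mterm : ℝ := (1 - Real.cos θ) / (3 * Real.pi ^ 2) with hmtermdef
  by_cases hcore : t * |θ| ≤ c₀
  · /- CORE regime -/
    have hθc₀ : |θ| ≤ c₀ := by
      have : |θ| ≤ t * |θ| := le_mul_of_one_le_left (abs_nonneg θ) ht
      exact this.trans hcore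
    have hθ1 : |θ| ≤ 1 := hθc₀.trans hc₀1
    -- twisted periodizations of both kernels (hypotheses `hrepU`, `hrepF`)
    choose cU hcU0 hcU1 hsumU using hrepU
    choose cF hcF0 hcF1 hsumF using hrepF
    -- the image majorant
    obtain ⟨hIsum, hIle⟩ := hI L hL1 t ht htL
    set Γimg : Site 4 → ℝ := fun n => CG * gaussProfile c_G t (fun μ => (L : ℤ) * n μ) with hΓimgdef
    have hΓsum : Summable Γimg := hIsum.mul_left CG
    have hΓ0 : ∀ n, 0 ≤ Γimg n := fun n => mul_nonneg hCG0 (gaussProfile_nonneg _ _ _)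
    have hΓtail : ∑' n : Site 4, (if n = 0 then 0 else Γimg n) ≤ CG * CI * Etail / t ^ 2 := by
      have hfun : (fun n : Site 4 => if n = 0 then (0:ℝ) else Γimg n) =
          fun n => CG * (if n = 0 then 0 else gaussProfile c_G t (fun μ => (L : ℤ) * n μ)) := by
        funext n; split_ifs <;> simp [hΓimgdef]
      rw [hfun, tsum_mul_left]
      have h1 : ∑' n : Site 4, (if n = 0 then 0 else gaussProfile c_G t (fun μ => (L : ℤ) * n μ)) ≤
          CI * Etail / t ^ 2 := by
        refine hIle.trans ?_
        have : C_I * Etail / t ^ 2 ≤ CI * Etail / t ^ 2 :=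
          div_le_div_of_nonneg_right (mul_le_mul_of_nonneg_right hCIle hEtail0) ht2.le
        simpa [hEtaildef] using this
      calc CG * ∑' n : Site 4, (if n = 0 then 0 else gaussProfile c_G t (fun μ => (L : ℤ) * n μ))
          ≤ CG * (CI * Etail / t ^ 2) := mul_le_mul_of_nonneg_left h1 hCG0
        _ = CG * CI * Etail / t ^ 2 := by ring
    -- entrywise majorant of the heat symbol for charges `|q| ≤ |θ|`
    have hmaj : ∀ q : ℝ, |q| ≤ |θ| → ∀ (w : Site 4) (α β : Fin 4),
        ‖symHeat q t w α β‖ ≤ CG * gaussProfile c_G t w := by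
      intro q hq w α β
      have hq1 : |q| ≤ c₁ := hq.trans (hθc₀.trans hc₀₁)
      have hq2 : |q| * t ≤ c₁ := by
        calc |q| * t ≤ |θ| * t := mul_le_mul_of_nonneg_right hq ht0.le
          _ = t * |θ| := by ring
          _ ≤ c₁ := hcore.trans hc₀₁
      exact (hG q t ht0.le hq1 hq2 w α β).trans
        (mul_le_mul_of_nonneg_right hCGle (gaussProfile_nonneg _ _ _))
    -- tails
    have htailU : ∀ (a : Fin 3) (α : Fin 4),
        ‖KU a α - symHeat (charge a θ) t 0 α α‖ ≤ CG * CI * Etail / t ^ 2 := by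
      intro a α
      have h0 : cU a α 0 * symHeat (charge a θ) t (fun μ => (L : ℤ) * (0 : Site 4) μ) α α =
          symHeat (charge a θ) t 0 α α := by
        rw [hcU0, one_mul, deck_zero]
      have := image_tail (hsumU a α) hΓsum hΓ0 (fun n hn => by
        rw [norm_mul, hcU1, one_mul]
        exact hmaj _ (abs_charge_le a θ) _ α α)
      rw [h0] at this
      exact this.trans hΓtail
    have htailF : ∀ (a : Fin 3) (α : Fin 4),
        ‖K1 a α - symHeat 0 t 0 α α‖ ≤ CG * CI * Etail / t ^ 2 := by
      intro a α
      have h0 : cF a α 0 * symHeat (charge a 0) t (fun μ => (L : ℤ) * (0 : Site 4) μ) α α =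
          symHeat 0 t 0 α α := by
        rw [hcF0, one_mul, deck_zero, charge_zero]
      have := image_tail (hsumF a α) hΓsum hΓ0 (fun n hn => by
        rw [norm_mul, hcF1, one_mul, charge_zero]
        exact hmaj 0 (by simp) _ α α)
      rw [h0] at this
      exact this.trans hΓtail
    -- the `n = 0` terms: `G q = tr[E^{(q)}_t(0) − E^{(0)}_t(0)]`
    set G : ℝ → ℂ := fun q => ∑ α : Fin 4, (symHeat q t 0 α α - symHeat 0 t 0 α α) with hGdef
    have hG0 : G 0 = 0 := by simp [hGdef]
    -- second-order expansion at `±θ`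
    have hθt₂ : |θ| * t ≤ c₂ := by rw [mul_comm]; exact hcore.trans hc₀₂
    have hEp := hE θ t ht hθt₂
    have hEm := hE (-θ) t ht (by rwa [abs_neg])
    have hexp : ‖G θ + G (-θ) - 2 * (θ : ℂ) ^ 2 * e2 t‖ ≤ 2 * CE * θ ^ 4 * t ^ 2 := by
      have e1 : G θ + G (-θ) - 2 * (θ : ℂ) ^ 2 * e2 t =
          (G θ - ((θ : ℂ) * a₁ t + (θ : ℂ) ^ 2 * e2 t + (θ : ℂ) ^ 3 * a₃ t)) +
          (G (-θ) - ((((-θ : ℝ)) : ℂ) * a₁ t + (((-θ : ℝ)) : ℂ) ^ 2 * e2 t + (((-θ : ℝ)) : ℂ) ^ 3 * a₃ t)) := by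
        push_cast; ring
      rw [e1]
      refine (norm_add_le _ _).trans ?_
      have hb1 : ‖G θ - ((θ : ℂ) * a₁ t + (θ : ℂ) ^ 2 * e2 t + (θ : ℂ) ^ 3 * a₃ t)‖ ≤ CE * θ ^ 4 * t ^ 2 :=
        hEp.trans (by gcongr)
      have hb2 : ‖G (-θ) - ((((-θ : ℝ)) : ℂ) * a₁ t + (((-θ : ℝ)) : ℂ) ^ 2 * e2 t + (((-θ : ℝ)) : ℂ) ^ 3 * a₃ t)‖ ≤
          CE * θ ^ 4 * t ^ 2 := by
        refine hEm.trans ?_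
        have : (-θ) ^ 4 = θ ^ 4 := by ring
        rw [this]
        gcongr
      linarith
    -- the coefficient
    have hcoef : |2 * θ ^ 2 * (e2 t).re - θ ^ 2 / (6 * Real.pi ^ 2)| ≤ 2 * Cκ * θ ^ 2 / t := by
      have hk := hκ t ht
      have e1 : 2 * θ ^ 2 * (e2 t).re - θ ^ 2 / (6 * Real.pi ^ 2) =
          2 * θ ^ 2 * (e2 t - ((1 / (12 * Real.pi ^ 2) : ℝ) : ℂ)).re := by
        simp only [Complex.sub_re, Complex.ofReal_re]
        ring
      rw [e1, abs_mul, abs_of_nonneg (by positivity : (0:ℝ) ≤ 2 * θ ^ 2)]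
      calc 2 * θ ^ 2 * |(e2 t - ((1 / (12 * Real.pi ^ 2) : ℝ) : ℂ)).re|
          ≤ 2 * θ ^ 2 * (C_κ / t) :=
            mul_le_mul_of_nonneg_left ((Complex.abs_re_le_norm _).trans hk) (by positivity)
        _ ≤ 2 * θ ^ 2 * (Cκ / t) := by gcongr
        _ = 2 * Cκ * θ ^ 2 / t := by ring
    have hcos := cos_main_term hθ1
    -- decompose the traced difference
    have hdecomp : (∑ a : Fin 3, ∑ α : Fin 4, (KU a α).re) - (∑ a : Fin 3, ∑ α : Fin 4, (K1 a α).re) =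
        ((G θ).re + (G (-θ)).re) +
        ∑ a : Fin 3, ∑ α : Fin 4, ((KU a α - symHeat (charge a θ) t 0 α α) - (K1 a α - symHeat 0 t 0 α α)).re := by
      have hGsum : ∑ a : Fin 3, (G (charge a θ)).re = (G θ).re + (G (-θ)).re := by
        rw [sum_charge (fun q => (G q).re) θ, hG0]; simp
      rw [← hGsum]
      simp only [hGdef, Complex.re_sum, Complex.sub_re, Finset.sum_sub_distrib]
      ring
    -- bound the image part
    have himg : |∑ a : Fin 3, ∑ α : Fin 4,
        ((KU a α - symHeat (charge a θ) t 0 α α) - (K1 a α - symHeat 0 t 0 α α)).re| ≤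
        24 * CG * CI * Etail / t ^ 2 := by
      refine (Finset.abs_sum_le_sum_abs _ _).trans ?_
      have hin : ∀ a : Fin 3, |∑ α : Fin 4,
          ((KU a α - symHeat (charge a θ) t 0 α α) - (K1 a α - symHeat 0 t 0 α α)).re| ≤
          ∑ _α : Fin 4, 2 * (CG * CI * Etail / t ^ 2) := by
        intro a
        refine (Finset.abs_sum_le_sum_abs _ _).trans (Finset.sum_le_sum fun α _ => ?_)
        refine (Complex.abs_re_le_norm _).trans ?_
        refine (norm_sub_le _ _).trans ?_
        linarith [htailU a α, htailF a α]
      calc ∑ a : Fin 3, |∑ α : Fin 4, ((KU a α - symHeat (charge a θ) t 0 α α) - (K1 a α - symHeat 0 t 0 α α)).re|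
          ≤ ∑ _a : Fin 3, ∑ _α : Fin 4, 2 * (CG * CI * Etail / t ^ 2) := Finset.sum_le_sum fun a _ => hin a
        _ = 24 * CG * CI * Etail / t ^ 2 := by
          simp only [Finset.sum_const, Finset.card_univ, Fintype.card_fin, nsmul_eq_mul]
          ring
    -- the real part of the `n = 0` terms
    have hmain : |(G θ).re + (G (-θ)).re - mterm| ≤
        2 * CE * θ ^ 4 * t ^ 2 + 2 * Cκ * θ ^ 2 / t + 5 / 96 * θ ^ 4 := by
      have hre : |(G θ).re + (G (-θ)).re - 2 * θ ^ 2 * (e2 t).re| ≤ 2 * CE * θ ^ 4 * t ^ 2 := by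
        have h2 : (G θ + G (-θ) - 2 * (θ : ℂ) ^ 2 * e2 t).re = (G θ).re + (G (-θ)).re - 2 * θ ^ 2 * (e2 t).re := by
          have e3 : (2 * (θ : ℂ) ^ 2 * e2 t) = ((2 * θ ^ 2 : ℝ) : ℂ) * e2 t := by push_cast; ring
          rw [Complex.sub_re, Complex.add_re, e3, Complex.re_ofReal_mul]
        rw [← h2]
        exact (Complex.abs_re_le_norm _).trans hexp
      have htri : |(G θ).re + (G (-θ)).re - mterm| ≤
          |(G θ).re + (G (-θ)).re - 2 * θ ^ 2 * (e2 t).re| +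
          |2 * θ ^ 2 * (e2 t).re - θ ^ 2 / (6 * Real.pi ^ 2)| +
          |θ ^ 2 / (6 * Real.pi ^ 2) - mterm| := by
        have := abs_add_three ((G θ).re + (G (-θ)).re - 2 * θ ^ 2 * (e2 t).re)
          (2 * θ ^ 2 * (e2 t).re - θ ^ 2 / (6 * Real.pi ^ 2)) (θ ^ 2 / (6 * Real.pi ^ 2) - mterm)
        have e : (G θ).re + (G (-θ)).re - mterm =
            ((G θ).re + (G (-θ)).re - 2 * θ ^ 2 * (e2 t).re) +
            (2 * θ ^ 2 * (e2 t).re - θ ^ 2 / (6 * Real.pi ^ 2)) + (θ ^ 2 / (6 * Real.pi ^ 2) - mterm) := by ring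
        rw [e]; exact this
      linarith [hre, hcoef, hcos, htri]
    -- assemble the core bound
    have hθ4 : θ ^ 4 ≤ θ ^ 4 * t ^ 2 := by
      have h1t : (1:ℝ) ≤ t ^ 2 := by simpa using pow_le_pow_left₀ zero_le_one ht 2
      exact le_mul_of_one_le_right (by positivity) h1t
    have hsplit : |(∑ a : Fin 3, ∑ α : Fin 4, (KU a α).re) - (∑ a : Fin 3, ∑ α : Fin 4, (K1 a α).re) - mterm| ≤
        |(G θ).re + (G (-θ)).re - mterm| +
        |∑ a : Fin 3, ∑ α : Fin 4, ((KU a α - symHeat (charge a θ) t 0 α α) - (K1 a α - symHeat 0 t 0 α α)).re| := by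
      rw [hdecomp]
      have e : (G θ).re + (G (-θ)).re +
          ∑ a : Fin 3, ∑ α : Fin 4, ((KU a α - symHeat (charge a θ) t 0 α α) - (K1 a α - symHeat 0 t 0 α α)).re -
          mterm = ((G θ).re + (G (-θ)).re - mterm) +
          ∑ a : Fin 3, ∑ α : Fin 4, ((KU a α - symHeat (charge a θ) t 0 α α) - (K1 a α - symHeat 0 t 0 α α)).re := by
        ring
      rw [e]; exact abs_add_le _ _
    have hθ2t : 0 ≤ θ ^ 2 / t := by positivity
    have hθ4t : 0 ≤ θ ^ 4 * t ^ 2 := by positivity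
    have hEt : 0 ≤ Etail / t ^ 2 := by positivity
    calc |(∑ a : Fin 3, ∑ α : Fin 4, (KU a α).re) - (∑ a : Fin 3, ∑ α : Fin 4, (K1 a α).re) - mterm|
        ≤ (2 * CE * θ ^ 4 * t ^ 2 + 2 * Cκ * θ ^ 2 / t + 5 / 96 * θ ^ 4) + 24 * CG * CI * Etail / t ^ 2 := by
          linarith [hsplit, hmain, himg]
      _ = (2 * Cκ) * (θ ^ 2 / t) + (2 * CE + 5 / 96 + Cwin) * (θ ^ 4 * t ^ 2) + (24 * CG * CI) * (Etail / t ^ 2) -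
            (5 / 96 * (θ ^ 4 * t ^ 2 - θ ^ 4) + Cwin * (θ ^ 4 * t ^ 2)) := by ring
      _ ≤ (2 * Cκ) * (θ ^ 2 / t) + (2 * CE + 5 / 96 + Cwin) * (θ ^ 4 * t ^ 2) + (24 * CG * CI) * (Etail / t ^ 2) := by
          have hx : 0 ≤ Cwin * (θ ^ 4 * t ^ 2) := mul_nonneg hCwin0 hθ4t
          have hy : 0 ≤ θ ^ 4 * t ^ 2 - θ ^ 4 := sub_nonneg.mpr hθ4
          have hz : 0 ≤ 5 / 96 * (θ ^ 4 * t ^ 2 - θ ^ 4) + Cwin * (θ ^ 4 * t ^ 2) := by positivity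
          linarith [hz]
      _ ≤ C * (θ ^ 2 / t) + C * (θ ^ 4 * t ^ 2) + C * (Etail / t ^ 2) := by
          gcongr
      _ = C * θ ^ 2 / t + C * θ ^ 4 * t ^ 2 + C * Etail / t ^ 2 := by ring
  · /- WINDOW regime -/
    push Not at hcore
    -- both kernels are `≤ C_W/t²` entrywise
    have hKU : ∀ (a : Fin 3) (α : Fin 4), ‖KU a α‖ ≤ CW / t ^ 2 := fun a α =>
      (hKUw a α).trans (div_le_div_of_nonneg_right hCWle ht2.le)
    have hK1 : ∀ (a : Fin 3) (α : Fin 4), ‖K1 a α‖ ≤ CW / t ^ 2 := fun a α =>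
      (hK1w a α).trans (div_le_div_of_nonneg_right hCWle ht2.le)
    have hsumK : ∀ K : Fin 3 → Fin 4 → ℂ, (∀ a α, ‖K a α‖ ≤ CW / t ^ 2) →
        |∑ a : Fin 3, ∑ α : Fin 4, (K a α).re| ≤ 12 * (CW / t ^ 2) := by
      intro K hK
      refine (Finset.abs_sum_le_sum_abs _ _).trans ?_
      have hin : ∀ a : Fin 3, |∑ α : Fin 4, (K a α).re| ≤ ∑ _α : Fin 4, CW / t ^ 2 := fun a =>
        (Finset.abs_sum_le_sum_abs _ _).trans
          (Finset.sum_le_sum fun α _ => (Complex.abs_re_le_norm _).trans (hK a α))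
      calc ∑ a : Fin 3, |∑ α : Fin 4, (K a α).re| ≤ ∑ _a : Fin 3, ∑ _α : Fin 4, CW / t ^ 2 :=
            Finset.sum_le_sum fun a _ => hin a
        _ = 12 * (CW / t ^ 2) := by
            simp only [Finset.sum_const, Finset.card_univ, Fintype.card_fin, nsmul_eq_mul]; ring
    have hU := hsumK KU hKU
    have hF := hsumK K1 hK1
    -- the main term is `≤ θ²/(6π²)` and nonnegative
    have hm0 : 0 ≤ mterm := div_nonneg (by linarith [Real.cos_le_one θ]) (by positivity)
    have hm1 : mterm ≤ θ ^ 2 / (6 * Real.pi ^ 2) := by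
      have hc : 1 - Real.cos θ ≤ θ ^ 2 / 2 := by linarith [Real.one_sub_sq_div_two_le_cos (x := θ)]
      have : θ ^ 2 / 2 / (3 * Real.pi ^ 2) = θ ^ 2 / (6 * Real.pi ^ 2) := by ring
      rw [hmtermdef, ← this]
      exact div_le_div_of_nonneg_right hc (by positivity)
    -- conversion of `1/t²` and `θ²` into `θ⁴t²` using `c₀ < t|θ|`
    have hθt : c₀ < |θ| * t := by rwa [mul_comm] at hcore
    have hprod4 : c₀ ^ 4 < (|θ| * t) ^ 4 := pow_lt_pow_left₀ hθt hc₀.le (by norm_num)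
    have hprod2 : c₀ ^ 2 < (|θ| * t) ^ 2 := pow_lt_pow_left₀ hθt hc₀.le (by norm_num)
    have habs2 : |θ| ^ 2 = θ ^ 2 := sq_abs θ
    have habs4 : |θ| ^ 4 = θ ^ 4 := by
      have : |θ| ^ 4 = (|θ| ^ 2) ^ 2 := by ring
      rw [this, sq_abs]; ring
    have hconv1 : 1 / t ^ 2 ≤ θ ^ 4 * t ^ 2 / c₀ ^ 4 := by
      rw [div_le_div_iff₀ ht2 (by positivity)]
      have : c₀ ^ 4 ≤ θ ^ 4 * t ^ 4 := by
        have := hprod4.le; rw [mul_pow, habs4] at this; exact this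
      have e : θ ^ 4 * t ^ 2 * t ^ 2 = θ ^ 4 * t ^ 4 := by ring
      rw [e]; linarith [this]
    have hconv2 : θ ^ 2 ≤ θ ^ 4 * t ^ 2 / c₀ ^ 2 := by
      rw [le_div_iff₀ (by positivity)]
      have : c₀ ^ 2 ≤ θ ^ 2 * t ^ 2 := by
        have := hprod2.le; rw [mul_pow, habs2] at this; exact this
      have h' := mul_le_mul_of_nonneg_left this (sq_nonneg θ)
      have e : θ ^ 2 * (θ ^ 2 * t ^ 2) = θ ^ 4 * t ^ 2 := by ring
      rw [e] at h'; exact h'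
    have hθ2t : 0 ≤ θ ^ 2 / t := by positivity
    have hθ4t : 0 ≤ θ ^ 4 * t ^ 2 := by positivity
    have hEt : 0 ≤ Etail / t ^ 2 := by positivity
    have htri : |(∑ a : Fin 3, ∑ α : Fin 4, (KU a α).re) - (∑ a : Fin 3, ∑ α : Fin 4, (K1 a α).re) - mterm| ≤
        |∑ a : Fin 3, ∑ α : Fin 4, (KU a α).re| + |∑ a : Fin 3, ∑ α : Fin 4, (K1 a α).re| + |mterm| :=
      (abs_sub _ _).trans (by gcongr; exact abs_sub _ _)
    have hmabs : |mterm| ≤ θ ^ 2 / (6 * Real.pi ^ 2) := by rw [abs_of_nonneg hm0]; exact hm1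
    calc |(∑ a : Fin 3, ∑ α : Fin 4, (KU a α).re) - (∑ a : Fin 3, ∑ α : Fin 4, (K1 a α).re) - mterm|
        ≤ 24 * CW * (1 / t ^ 2) + θ ^ 2 / (6 * Real.pi ^ 2) := by
          have : 12 * (CW / t ^ 2) + 12 * (CW / t ^ 2) = 24 * CW * (1 / t ^ 2) := by ring
          linarith [htri, hU, hF, hmabs]
      _ ≤ 24 * CW * (θ ^ 4 * t ^ 2 / c₀ ^ 4) + (θ ^ 4 * t ^ 2 / c₀ ^ 2) / (6 * Real.pi ^ 2) := by
          gcongr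
      _ = Cwin * (θ ^ 4 * t ^ 2) := by
          rw [hCwindef]; field_simp
      _ ≤ (2 * Cκ) * (θ ^ 2 / t) + (2 * CE + 5 / 96 + Cwin) * (θ ^ 4 * t ^ 2) + (24 * CG * CI) * (Etail / t ^ 2) := by
          have hx1 : 0 ≤ (2 * Cκ) * (θ ^ 2 / t) := mul_nonneg (by positivity) hθ2t
          have hx2 : 0 ≤ (2 * CE + 5 / 96) * (θ ^ 4 * t ^ 2) := mul_nonneg (by positivity) hθ4t
          have hx3 : 0 ≤ (24 * CG * CI) * (Etail / t ^ 2) := mul_nonneg (by positivity) hEt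
          linarith [hx1, hx2, hx3]
      _ ≤ C * (θ ^ 2 / t) + C * (θ ^ 4 * t ^ 2) + C * (Etail / t ^ 2) := by
          gcongr
      _ = C * θ ^ 2 / t + C * θ ^ 4 * t ^ 2 + C * Etail / t ^ 2 := by ring


/-- **The skeleton IS the crux proof modulo the declared stubs**: `QuarkLoopCoefficient_of` concludes
`HeatSlicedQuarks.QuarkLoopCoefficient` BY NAME from the seven `stub_*` of §1 (through `traced_bound`): window
regime `c₀ < t|θ|` by `stub_windowBound` (for `U` and for `U ≡ 1`); core regime `t|θ| ≤ c₀` by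
`stub_torusToPlane` (for `U` and `U ≡ 1`), the images by `gaussianMajorant_holds` summed with
`stub_freeMajorantToolkit` (6), the `n = 0` terms by `secondOrderExpansion_holds` at `±θ` (odd orders cancel) and
`secondOrderCoefficient_holds`, and `|θ²/2 − (1 − cos θ)| ≤ 5θ⁴/96`. -/
theorem QuarkLoopCoefficient_of :
    Summit.QuantumFields.QCD.Theses.HeatSlicedQuarks.QuarkLoopCoefficient := by
  obtain ⟨C_W, hW⟩ := stub_windowBound
  obtain ⟨C, c, hc, hmain⟩ := traced_bound C_W
  refine ⟨C, c, hc, ?_⟩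
  intro L _ U θ h1 h2 h3 t ht htL htθ x
  have hL1 : 1 ≤ L := Nat.one_le_iff_ne_zero.mpr (NeZero.ne L)
  have ht0 : 0 ≤ t := le_trans zero_le_one ht
  exact hmain L hL1 θ t ht htL htθ
    (fun a α => torusHeat U t (x, a, α) (x, a, α))
    (fun a α => torusHeat (fun _ : Edge 4 L => (1 : Matrix.specialUnitaryGroup (Fin 3) ℂ)) t (x, a, α) (x, a, α))
    (fun a α => hW L U θ h1 h2 h3 t ht htL htθ x a α)
    (fun a α => hW L (fun _ : Edge 4 L => (1 : Matrix.specialUnitaryGroup (Fin 3) ℂ)) 0 (free_offdiag L)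
      (free_flux L) (free_flat L) t ht htL (by simp) x a α)
    (fun a α => stub_torusToPlane L U θ h1 h2 h3 t ht0 x a α)
    (fun a α => stub_torusToPlane L (fun _ : Edge 4 L => (1 : Matrix.specialUnitaryGroup (Fin 3) ℂ)) 0
      (free_offdiag L) (free_flux L) (free_flat L) t ht0 x a α)

end Summit.QuantumFields.QCD.Cruxes.QuarkLoopCoefficient.Sketch

end
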